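import Summits.QuantumFields.YangMills.Theorems.BalabanUVNodesK0Stub1Eq157FlatScaledS1
import Summits.QuantumFields.YangMills.Theorems.BalabanUVNodesN07FlatChartLineStationarityLam
import Summits.QuantumFields.YangMills.Theorems.UnitScaleTiltProp8Chart47Analytic
import HarnessLib

/-!
# N07 (d′)-Lam, (R1) W2: the ♭ (127) socket at one family with the criticality in CELL FORM (S4-Lam, second wrapper)

WHY (n07-e memo `LOCATED-DPRIME-CALIBRATION` §4 (R1), `DPRIME-LAM-ROADMAP` §2).  k0-s1-w2's `K0Stub1SocketFlatAtRecord.socket127_flat_of_letters` (the ♭ (127) socket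
`⟪δX, Δ_1X₁⟫ + Re φ(δ) = 0` at one nested family, letters displayed) asks the criticality of the charted configuration as `Node00.IsCritOnFibre F N K 𝔹 …` for a determining
set `𝔹` of (2.3) index bonds — more than print's criticality ([15] (156)–(157): stationarity along curves keeping the averages on the CELLS of the family), which is all the N07
head token can supply at a datum (n07-e MODULES 101–104).  This file is the same junction over n07-e's W1-Lam (`…N07FlatChartLineStationarityLam`), the cell form threaded through.

WHAT IS PROVED (sorry-free; no definition; axioms standard): ★★★ `socket127_flat_of_letters_lam` — k0-s1-w2 §1 VERBATIM (nested `D`, the (152) weights, the letters of D‴ by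
shape, the sup row of `H♭`, the radius rows, `A′₁` with the (157) certificate, `δ ∈ ker Qlin♭`, `U₁` reading `e^{iη(A′₁ − H♭Dsel A′₁)}`, the tangent letters) with the binders
`(𝔹) (h𝔹) (hcrit : IsCritOnFibre …)` replaced by the CORE's cell-form `hcrit` ⟹ **`⟪δX, Δ_1X₁⟫ + Re φ(δ) = 0`**; proof = k0-s1-w2's (`inner_hessOpAt_add_re_eq_zero_of_stationary`,
`coe_expChart_one_eq_coe_expCfg`, cited by name) over W1-Lam.
HONEST FRAMING: a re-cut of one wrapper, no new analysis; NOTHING of [15]'s estimates asserted; (d′) ∕ `HThm4RecDbar` ∕ budget row of MODULE 100 untouched; K0⁷ NOT closed;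
N07 NOT discharged; counts unmoved; one finite 𝕋⁴ programme at fixed ε — NOT continuum ∕ ℝ⁴ ∕ OS ∕ mass gap ∕ Clay.  No `sorry`, no `def`, no `instance`, no `notation`.

References: [15] = Balaban1985Variational (44)–(50) p.285, (55) p.286, (80) p.290, (127)–(128) p.297, (152) p.301, (156)–(158) p.302; Balaban1985Averaging (92) p.31, (134) p.38;
Balaban1984PropagatorsII (2.3) p.224; Balaban1988Convergent (2.10)–(2.12) p.256.
-/

set_option autoImplicit false

noncomputable section

open scoped BigOperators Matrix InnerProductSpace RealInnerProductSpace Matrix.Norms.L2Operator Topology ContDiff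
open Filter

namespace Summit.QuantumFields.YangMills.BalabanUVNodes.N07SocketFlatAtRecordLam

open Literature.MathematicalPhysics.QuantumFieldTheory.Balaban1983to89
open Literature.MathematicalPhysics.QuantumFieldTheory.Balaban1983to89.Node00
open T4Continuum (T4Family)
open ExpMeanLog (deltaSU deltaSU_pos)
open T4AdjointCovarianceUnitary (lieSU)
open B9AdOrthogonal (herm0)
open B15DeterminingSets (bondsOf DetSet avgFamily)
open B6SectADomainsV1 (Domains)
open B6SectAOperatorsV1 (BondIdx aE)
open B6SectAVectorModelV1 (EE)
open B11Eq26ActionExpansion (V0)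
open MatrixNorms (ntr)
open Summit.QuantumFields.YangMills.Theorems.K0FlatCubeOpsTextP (IsLevWeight flatH)
open Summit.QuantumFields.YangMills.Theorems.Prop8Chart (expCfg)
open Summit.QuantumFields.YangMills.Theorems.Prop8ChartDoubleBar (chartLogFlat)
open Summit.QuantumFields.YangMills.Theorems.Chart47Analytic (isOpen_wBall)
open Summit.QuantumFields.YangMills.Theorems.K0Stub1Eq157FlatScaledS1 (inner_hessOpAt_add_re_eq_zero_of_stationary coe_expChart_one_eq_coe_expCfg)
open Summit.QuantumFields.YangMills.Theorems.K0Stub1FlatChartCriticalityTransfer (eventually_ofReal)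
open Summit.QuantumFields.YangMills.BalabanUVNodes.N07FlatChartLineStationarityLam (exists_suReading_hasDerivAt_wilsonAction4_zero_of_letters_lam)
open Summit.QuantumFields.YangMills.BalabanUVNodes.N07ChartLogReality (I_eta_smul_mem_lieSU)

section Letters

variable (F : T4Family) (N : ℕ) [NeZero N] (K k : ℕ) (D : Domains (F.P K)) (hDk : D.k = k)
  (hcollar : ∀ (i : ℕ) (e : PBond (F.P K) (i + 1)), D.LamBond (i + 1) e → ∀ z : Site (F.P K) i, (blockOf z = e.src ∨ blockOf z = e.tgt) → z ∈ D.Om i)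

include hDk hcollar in
/-- ★★★ **THE ♭ (127) SOCKET, LETTERS DISPLAYED — CELL-FORM (Lam) EDITION** of k0-s1-w2 `K0Stub1SocketFlatAtRecord.socket127_flat_of_letters`: every letter VERBATIM except that the criticality of the charted configuration `U₁` is asked in the CORE's cell form (stationarity of `𝔄` along differentiable `SU(N)` curves through `U₁` keeping the averages on the (2.3) CELLS `D.LamBond j c`, `j ≤ k`) instead of `IsCritOnFibre F N K 𝔹 …` for a determining set; proof = k0-s1-w2's, over n07-e W1-Lam `exists_suReading_hasDerivAt_wilsonAction4_zero_of_letters_lam` (see the module docstring, §1). [cite: Balaban1985Variational, (127)-(128) p.297, (157) p.302, (44)-(50) p.285, (55) p.286, (80) p.290; Balaban1985Averaging, (92) p.31, Prop. 4 (134)-(135) p.38; Balaban1988Convergent, (2.10)-(2.12) p.256] -/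
theorem socket127_flat_of_letters_lam {w : ℕ → PBond (F.P K) 0 → ℝ} (hw : IsLevWeight (F.P K) k D w)
    (hc : ((F.P K).L : ℝ) ^ k ≠ 0) (hwa : ∀ _i : BondIdx D, (0 : ℝ) < 1)
    (τ : Matrix (Fin N) (Fin N) ℂ →L[ℂ] ℂ) (hntr : ∀ X, τ X = ntr X)
    (B : (BondIdx D → Matrix (Fin N) (Fin N) ℂ) →L[ℂ] (BondIdx D → Matrix (Fin N) (Fin N) ℂ) →L[ℂ] ℂ)
    (hB : ∀ X X' : BondIdx D → Matrix (Fin N) (Fin N) ℂ, B X X' = ∑ t, τ (X t * X' t))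
    (MV : (BondIdx D → Matrix (Fin N) (Fin N) ℂ) →L[ℂ] (BondIdx D → Matrix (Fin N) (Fin N) ℂ))
    (hMV : ∀ (X : BondIdx D → Matrix (Fin N) (Fin N) ℂ) (t : BondIdx D),
      MV X t = ∑ s, (((((F.P K).L : ℝ) ^ (t.1.1 : ℕ) * ((((F.P K).L : ℝ))⁻¹) ^ k)⁻¹ *
        WithLp.ofLp ((EE D hc hwa - aE D (fun _ => (1 : ℝ))) (WithLp.toLp 2 (Pi.single s 1))) t *
        (((F.P K).L : ℝ) ^ (s.1.1 : ℕ) * ((((F.P K).L : ℝ))⁻¹) ^ k)⁻¹ : ℝ) : ℂ) • X s)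
    (H : (BondIdx D → Matrix (Fin N) (Fin N) ℂ) →ₗ[ℂ] (PBond (F.P K) 0 → Matrix (Fin N) (Fin N) ℂ))
    (hH : ∀ (X : BondIdx D → Matrix (Fin N) (Fin N) ℂ) (b : PBond (F.P K) 0), H X b =
      ∑ t, (((((F.P K).L : ℝ) ^ (t.1.1 : ℕ) * ((((F.P K).L : ℝ))⁻¹) ^ k)⁻¹ * flatH (F.P K) k D (Pi.single t 1) b : ℝ) : ℂ) • X t)
    {Bf : ℝ} (hBf : 0 ≤ Bf)
    (hHB : ∀ (X : BondIdx D → Matrix (Fin N) (Fin N) ℂ) (t : ℝ), 0 ≤ t → (∀ i, ‖X i‖ ≤ t) → ∀ b, w 1 b * ‖H X b‖ ≤ Bf * t)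
    (Dsel : (PBond (F.P K) 0 → Matrix (Fin N) (Fin N) ℂ) → (BondIdx D → Matrix (Fin N) (Fin N) ℂ)) {ε CD : ℝ} (hε : 0 < ε) (hCD : 0 ≤ CD)
    (h55 : ∀ A' : PBond (F.P K) 0 → Matrix (Fin N) (Fin N) ℂ, (∀ b, w 1 b * ‖A' b‖ < ε) →
      ∀ ρ' : ℝ, 0 ≤ ρ' → (∀ b, w 1 b * ‖A' b‖ ≤ ρ') → ∀ i : BondIdx D, ‖Dsel A' i‖ ≤ CD * ρ' ^ 2)
    (hcd : ContDiffOn ℂ ω Dsel {Y : PBond (F.P K) 0 → Matrix (Fin N) (Fin N) ℂ | ∀ b, w 1 b * ‖Y b‖ < ε})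
    (h48 : ∀ A' : PBond (F.P K) 0 → Matrix (Fin N) (Fin N) ℂ, (∀ b, w 1 b * ‖A' b‖ < ε) →
      chartLogFlat ((((F.P K).L : ℝ)⁻¹) ^ k) D (A' - H (Dsel A')) = (fderiv ℂ (chartLogFlat ((((F.P K).L : ℝ)⁻¹) ^ k) D :
        (PBond (F.P K) 0 → Matrix (Fin N) (Fin N) ℂ) → BondIdx D → Matrix (Fin N) (Fin N) ℂ) 0) A')
    (hherm : ∀ A' : PBond (F.P K) 0 → Matrix (Fin N) (Fin N) ℂ, (∀ b, w 1 b * ‖A' b‖ < ε) → (∀ b, A' b ∈ herm0 (Fin N)) →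
      (∀ i, Dsel A' i ∈ herm0 (Fin N)) ∧ ∀ b, (A' - H (Dsel A')) b ∈ herm0 (Fin N))
    -- the radius of dag-k0-s1-w1's transfer and the smallness of `ε` against it
    {R : ℝ} (hRL : 60800 * ((((F.P K).d + 2) * (F.P K).L : ℕ) : ℝ) ^ 2 * ((F.P K).L : ℝ) * R ≤ 1)
    (hguard : 60 * ((((F.P K).d + 2) * (F.P K).L : ℕ) : ℝ) ^ 2 * ((F.P K).L : ℝ) * R < deltaSU (Fin N)) (hεR : ε + Bf * CD * ε ^ 2 ≤ R)
    -- the base point, the (157) certificate there, the kernel direction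
    (A₁ δ : PBond (F.P K) 0 → Matrix (Fin N) (Fin N) ℂ) (hA₁ : ∀ b, w 1 b * ‖A₁ b‖ < ε) (hA₁h : ∀ b, A₁ b ∈ herm0 (Fin N)) (hδh : ∀ b, δ b ∈ herm0 (Fin N))
    (hδQ : (fderiv ℂ (chartLogFlat ((((F.P K).L : ℝ)⁻¹) ^ k) D :
      (PBond (F.P K) 0 → Matrix (Fin N) (Fin N) ℂ) → BondIdx D → Matrix (Fin N) (Fin N) ℂ) 0) δ = 0)
    {φ : (PBond (F.P K) 0 → Matrix (Fin N) (Fin N) ℂ) →L[ℂ] ℂ}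
    (h157 : HasFDerivAt (fun A : PBond (F.P K) 0 → Matrix (Fin N) (Fin N) ℂ =>
        2⁻¹ * B (Dsel A) (((((((((F.P K).L : ℝ))⁻¹) ^ k : ℝ) : ℂ) ^ (F.P K).d) • MV) (Dsel A))
          - B ((fderiv ℂ (chartLogFlat (((((F.P K).L : ℝ))⁻¹) ^ k) D :
              (PBond (F.P K) 0 → Matrix (Fin N) (Fin N) ℂ) → BondIdx D → Matrix (Fin N) (Fin N) ℂ) 0) A)
              (((((((((F.P K).L : ℝ))⁻¹) ^ k : ℝ) : ℂ) ^ (F.P K).d) • MV) (Dsel A))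
          + V0 (LatticeFieldCalculus.shiftEquiv (P := F.P K) (j := 0)) (fun _ _ => (1 : (Matrix (Fin N) (Fin N) ℂ)ˣ)) ((((F.P K).L : ℝ)⁻¹) ^ k) (F.P K).d
              (τ : Matrix (Fin N) (Fin N) ℂ →ₗ[ℂ] ℂ) (fun μ x => (A - H (Dsel A)) ⟨x, μ⟩)) φ A₁)
    -- the criticality of the charted configuration, CELL FORM (print's (ii)-reading of [15] (156)–(157); no determining set)
    (U₁ : GaugeField (F.P K) 0 (SU N))
    (hU₁ : ∀ b, ((U₁ b : SU N) : Matrix (Fin N) (Fin N) ℂ) = ((expCfg ((((F.P K).L : ℝ)⁻¹) ^ k) (A₁ - H (Dsel A₁)) b : (Matrix (Fin N) (Fin N) ℂ)ˣ) : _))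
    (hcrit : ∀ γ : ℝ → GaugeField (F.P K) 0 (SU N), γ 0 = U₁ →
      DifferentiableAt ℝ (fun (t : ℝ) (b : PBond (F.P K) 0) => ((γ t b : SU N) : Matrix (Fin N) (Fin N) ℂ)) 0 →
      (∀ (t : ℝ) (j : ℕ) (c : PBond (F.P K) j), j ≤ k → D.LamBond j c → avgFamily (avOfRecord F N K) (γ t) j c = avgFamily (avOfRecord F N K) U₁ j c) →
      HasDerivAt (fun t => wilsonAction4 (γ t)) 0 0)
    -- the tangent letters
    (X₁ δX : TangentBondSU (F.P K) 0 N)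
    (hX₁ : ∀ b, ((X₁ b : lieSU (Fin N)) : Matrix (Fin N) (Fin N) ℂ) = (Complex.I * (((((F.P K).L : ℝ)⁻¹) ^ k : ℝ) : ℂ)) • A₁ b)
    (hδX : ∀ b, ((δX b : lieSU (Fin N)) : Matrix (Fin N) (Fin N) ℂ) = (Complex.I * (((((F.P K).L : ℝ)⁻¹) ^ k : ℝ) : ℂ)) • δ b) :
    ⟪δX, hessOpAt ((((F.P K).L : ℝ)⁻¹) ^ k) (1 : GaugeField (F.P K) 0 (SU N)) X₁⟫_ℝ + (φ δ).re = 0 := by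
  classical
  set η : ℝ := (((F.P K).L : ℝ)⁻¹) ^ k with hηdef
  have hd : (F.P K).d = 4 := T4Family.P_d F K
  have hR0 : 0 ≤ R := le_trans (by positivity) hεR
  -- (a) dag-k0-s1-w1's stationarity along the charted line (p640294 §4: the complex charted family `(A′₁ + zδ) − H♭Dsel♭(A′₁ + zδ)`, `hball` by (55)♭ + the row,
  -- `hidx` by (48)♭ + the kernel, `SU(N)` readings by the reality of the chart, dag-k0-s1-w1 FILE 5's transfer)
  obtain ⟨U, -, hUread, hstatU⟩ := exists_suReading_hasDerivAt_wilsonAction4_zero_of_letters_lam F N K k D hDk hcollar hw hR0 hRL hguard H Dsel hε.le le_rfl hCD hεR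
    hHB h55 hcd h48 hherm A₁ δ hA₁ hA₁h hδQ hδh U₁ hU₁ hcrit
  -- the line stays in the `ε`-ball near `0`
  have hlin : Continuous fun z : ℂ => A₁ + z • δ := continuous_const.add (continuous_id.smul continuous_const)
  have hball₁ : ∀ᶠ z in 𝓝 (0 : ℂ), ∀ b, w 1 b * ‖(A₁ + z • δ) b‖ < ε := by
    have h0 : (fun z : ℂ => A₁ + z • δ) 0 ∈ {Y : PBond (F.P K) 0 → Matrix (Fin N) (Fin N) ℂ | ∀ b, w 1 b * ‖Y b‖ < ε} := by
      simpa only [Set.mem_setOf_eq, zero_smul, add_zero] using hA₁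
    exact hlin.continuousAt.eventually_mem ((isOpen_wBall (w 1) ε).mem_nhds h0)
  -- reality along the real line: the tangent curve and the `SU(N)` readings
  have hreal : ∀ᶠ t : ℝ in 𝓝 0, (∀ b, w 1 b * ‖(A₁ + (t : ℂ) • δ) b‖ < ε) ∧ ∀ b, (A₁ + (t : ℂ) • δ) b ∈ herm0 (Fin N) := by
    filter_upwards [eventually_ofReal hball₁] with t ht
    refine ⟨ht, fun b => ?_⟩
    rw [Pi.add_apply, Pi.smul_apply, Complex.coe_smul]
    exact Submodule.add_mem _ (hA₁h b) (Submodule.smul_mem _ t (hδh b))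
  have hDh : ∀ᶠ t : ℝ in 𝓝 0, ∀ i, Dsel (A₁ + (t : ℂ) • δ) i ∈ herm0 (Fin N) := hreal.mono fun t ht => (hherm _ ht.1 ht.2).1
  set A : ℂ → PBond (F.P K) 0 → Matrix (Fin N) (Fin N) ℂ := fun z => (A₁ + z • δ) - H (Dsel (A₁ + z • δ)) with hA
  let Xc : ℝ → TangentBondSU (F.P K) 0 N := fun t => WithLp.toLp 2 fun b =>
    if h : A (t : ℂ) b ∈ herm0 (Fin N) then ⟨(Complex.I * (η : ℂ)) • A (t : ℂ) b, I_eta_smul_mem_lieSU η h⟩ else 0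
  have hXc : ∀ᶠ t : ℝ in 𝓝 0, ∀ b, ((Xc t b : lieSU (Fin N)) : Matrix (Fin N) (Fin N) ℂ) =
      (Complex.I * (η : ℂ)) • ((A₁ + (t : ℂ) • δ) b - H (Dsel (A₁ + (t : ℂ) • δ)) b) := by
    filter_upwards [hreal] with t ht
    intro b
    have hmem : A (t : ℂ) b ∈ herm0 (Fin N) := (hherm _ ht.1 ht.2).2 b
    have hval : (Xc t b : lieSU (Fin N)) = ⟨(Complex.I * (η : ℂ)) • A (t : ℂ) b, I_eta_smul_mem_lieSU η hmem⟩ := by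
      show (if h : A (t : ℂ) b ∈ herm0 (Fin N) then (⟨(Complex.I * (η : ℂ)) • A (t : ℂ) b, I_eta_smul_mem_lieSU η h⟩ : lieSU (Fin N)) else 0) = _
      rw [dif_pos hmem]
    rw [hval]
    simp only [hA, Pi.sub_apply]
  -- the tangent curve reads the same `SU(N)` configuration as dag-k0-s1-w1's `U`
  have hstat : HasDerivAt (fun t : ℝ => wilsonAction4 (expChart (1 : GaugeField (F.P K) 0 (SU N)) (WithLp.ofLp (Xc t)))) 0 0 := by
    refine hstatU.congr_of_eventuallyEq ?_
    filter_upwards [hUread, hXc] with t hUt hXt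
    show wilsonAction4 (expChart (1 : GaugeField (F.P K) 0 (SU N)) (WithLp.ofLp (Xc t))) = wilsonAction4 (U t)
    congr 1
    funext b
    exact Subtype.ext ((coe_expChart_one_eq_coe_expCfg η (WithLp.ofLp (Xc t)) ((A₁ + (t : ℂ) • δ) - H (Dsel (A₁ + (t : ℂ) • δ))) hXt b).trans (hUt b).symm)
  -- (b) the (157) split turns it into the socket equation
  exact inner_hessOpAt_add_re_eq_zero_of_stationary D k hd hc hwa τ hntr B hB MV hMV H hH Dsel A₁ δ hA₁h hδh hDh X₁ δX hX₁ hδX Xc hXc h157 hstat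

end Letters

end Summit.QuantumFields.YangMills.BalabanUVNodes.N07SocketFlatAtRecordLam

end
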